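import Literature.AnabelianGeometry.EtaleTheta.Discharge.Sec5Prop53LabelsR

/-!
# [EtTh] §5, Proposition 5.3 (v) from (i), (ii), F1-Ψ and the printed adjacency criterion, over ORDER COORDINATES
# (a NON-VACUOUS instance form: no "monoid type `ℤ`" structure; valid at PERFECT `Φ(A_⊚)`) — row F-0563

Mochizuki, *The étale theta function and its Frobenioid-theoretic manifestations*, Publ. RIMS **45** (2009), §5,
Prop. 5.3 (v) p. 325 (PDF p. 99): `Ψ^Φ_{A_⊚}` preserves "the natural bijection `Prime(Φ(A_⊚))^ncsp ⥲ ℤ` [up to `±1` and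
translation]"; proof p. 327 (PDF p. 101): "it suffices to show that the relation of adjacency … is preserved … if `a ∈ 𝔭`,
`b ∈ 𝔮` correspond via the natural isomorphisms of (ii), then `𝔭, 𝔮` are adjacent if and only if every cuspidally minimal
`c ∈ Φ(A_⊚)^gp` which is linearly equivalent to `a + b` has support of cardinality 4" [cite: MochizukiEtTh2009, Prop 5.3 (v)
p.325 (PDF p.99)]; Prop. 3.2 (i) p. 296 (PDF p. 70) (product-valued factorization); Prop. 5.1 p. 323 (PDF p. 97) (`Φ(−)`
PERFECT).  Cell abc-iut, block F, seat abc-iut-f-128 (tranche 128, row F-0563 `PreservesNcspLabels`).  PROOF-ONLY companion (no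
`def`, no instance, nothing landed is edited) of abc-iut-L2-t4's `FrobenioidThetaDivisors.lean`; it re-runs abc-iut-L6-d1's
`Sec5Prop53LabelsR.lean` (`adjacency_preserved_of_criterion'`, `preservesNcspLabels_of_supportData'`) with the structure
argument `𝔖 : DivisorSupportData' 𝔓` replaced by EXPLICIT HYPOTHESIS BINDERS.

WHY.  The deep instance forms of record of F-0563 (`preservesNcspLabels_of_supportData'` / `…_of_adjacencyCriterion`) take
`𝔖 : DivisorSupportData'(') 𝔓`, which abc-iut-f-127 proved UNINHABITED at every §5 datum with perfect `Φ(A_⊚)` (p434934) —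
print's own hypothesis (Prop. 5.1).  The derivation needs no `ℤ_{≥0}`-components; it needs only: a product-valued
factorization `factor : Φ(A_⊚) → ∏_𝔭 ℚ` (Prop. 3.2 (i); any homomorphism — the `ℚ_{≥0}`-coefficients at a perfect datum) whose
orders `Ψ^Φ_{A_⊚}` carries along, `ord_{Ψ^Φ𝔭}(Ψ^Φ a) = ord_𝔭(a)` (`hψo`; at monoid type `ℤ` a theorem, L6-d1's `ordOf'_map`);
the principal elements `P ⊆ Φ(A_⊚)^gp` (F1) preserved by `(Ψ^Φ)^gp` (`hP`, F1-Ψ); Prop. 5.3 (i) on primes (`hc`) and (ii) (`hii`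
— print: "correspond via the natural isomorphisms of (ii)"); and the printed adjacency criterion (`hAdj`, verbatim first clause
of L6-d1's `AdjacencyCriterion'`, read over `factor` / `P`: GAP-LEDGER G-L2d4-2, derived there from the intersection theory
of the chain).  Supports, cuspidality, finiteness, cardinalities, linear equivalence and cuspidal minimality are then
transported along `Ψ^Φ` (`…_of_ordMap` lemmas), adjacency is preserved (`adjacency_preserved_of_orders`), and (v) follows by
abc-iut-L2-d4's rigidity of the chain (`preservesNcspLabels_of_adjacency`).
RESULT: **`preservesNcspLabels_of_orders`** — (v) under these binders; satisfiable structural data at PERFECT `Φ(A_⊚)`.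

HONEST FRAMING: kernel-checked implication about the TYPED data; the criterion `hAdj` is print's claim recorded as a binder,
not decided here; typed ≠ proved; no side taken on [IUTchIII] Cor. 3.12 or on any author.
-/

namespace Literature.AnabelianGeometry.EtaleTheta

open CategoryTheory
open Literature.AlgebraicGeometry.Frobenioids

universe w v v' u u'

namespace FrobenioidThetaDivisors

/-! ### Transport along `Ψ^Φ` from the transport of orders on `Φ(A_⊚)` -/

section Transport

variable {C : Type u} [Category.{v} C] {D : Type u'} [Category.{v'} D] {𝔉 : ThetaFrobenioid.{w} C D}
  (𝔓 : DivisorPrimeData 𝔉) (factor : 𝔉.PhiAcirc →* (Primes 𝔉.PhiAcirc → Multiplicative ℚ))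
  (ψ : 𝔉.PhiAcirc ≃* 𝔉.PhiAcirc)
  (hψo : ∀ (𝔭 : Primes 𝔉.PhiAcirc) (a : 𝔉.PhiAcirc), ordOf' factor (Primes.congr ψ 𝔭) (ψ a) = ordOf' factor 𝔭 a)
include hψo

/-- The orders on `Φ(A_⊚)^gp` are transported: `ord_{ψ𝔭}(ψ^gp x) = ord_𝔭(x)` (from `hψo` by the universal property).
[cite: MochizukiEtTh2009, Prop 5.3 proof p.326 (PDF p.100)] -/
theorem ordGpOf'_gpMap_of_ordMap (𝔭 : Primes 𝔉.PhiAcirc) (x : Algebra.GrothendieckGroup 𝔉.PhiAcirc) :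
    ordGpOf' factor (Primes.congr ψ 𝔭) (ThetaFrobenioid.gpMap ψ.toMonoidHom x) = ordGpOf' factor 𝔭 x := by
  have hof : ∀ (𝔮 : Primes 𝔉.PhiAcirc) (a : 𝔉.PhiAcirc),
      ordGpOf' factor 𝔮 (Algebra.GrothendieckGroup.of a) = ordOf' factor 𝔮 a := fun 𝔮 a => by
    have h := Algebra.GrothendieckGroup.lift.symm_apply_apply (ordOf' factor 𝔮)
    rw [Algebra.GrothendieckGroup.lift_symm_apply] at h
    exact DFunLike.congr_fun h a
  have : (ordGpOf' factor (Primes.congr ψ 𝔭)).comp (ThetaFrobenioid.gpMap ψ.toMonoidHom) = ordGpOf' factor 𝔭 :=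
    DivisorSupportData.gpHom_ext fun a => by
      rw [MonoidHom.comp_apply, ThetaFrobenioid.gpMap_of, hof, MulEquiv.coe_toMonoidHom, hof]
      exact hψo 𝔭 a
  exact DFunLike.congr_fun this x

/-- Supports are transported: `supp(ψ^gp x) = ψ(supp x)`. [cite: MochizukiEtTh2009, Prop 5.3 proof p.326 (PDF p.100)] -/
theorem supp_gpMap_of_ordMap (x : Algebra.GrothendieckGroup 𝔉.PhiAcirc) :
    suppOf' factor (ThetaFrobenioid.gpMap ψ.toMonoidHom x) = Primes.congr ψ '' suppOf' factor x := by
  ext 𝔮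
  constructor
  · intro h
    refine ⟨Primes.congr ψ.symm 𝔮, ?_, Primes.congr_apply_congr_symm ψ 𝔮⟩
    change ordGpOf' factor (Primes.congr ψ.symm 𝔮) x ≠ 1
    rw [← ordGpOf'_gpMap_of_ordMap factor ψ hψo (Primes.congr ψ.symm 𝔮) x, Primes.congr_apply_congr_symm]
    exact h
  · rintro ⟨𝔭, h𝔭, rfl⟩
    change ordGpOf' factor (Primes.congr ψ 𝔭) _ ≠ 1
    rw [ordGpOf'_gpMap_of_ordMap factor ψ hψo]
    exact h𝔭

/-- Cardinalities of supports are preserved. [cite: MochizukiEtTh2009, Prop 5.3 proof p.326 (PDF p.100)] -/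
theorem ncard_supp_gpMap_of_ordMap (x : Algebra.GrothendieckGroup 𝔉.PhiAcirc) :
    (suppOf' factor (ThetaFrobenioid.gpMap ψ.toMonoidHom x)).ncard = (suppOf' factor x).ncard := by
  rw [supp_gpMap_of_ordMap factor ψ hψo, Set.ncard_image_of_injective _ (Primes.congr ψ).injective]

/-- Finiteness of supports is preserved. [cite: MochizukiEtTh2009, Prop 5.3 proof p.326 (PDF p.100)] -/
theorem finite_supp_gpMap_iff_of_ordMap (x : Algebra.GrothendieckGroup 𝔉.PhiAcirc) :
    (suppOf' factor (ThetaFrobenioid.gpMap ψ.toMonoidHom x)).Finite ↔ (suppOf' factor x).Finite := by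
  rw [supp_gpMap_of_ordMap factor ψ hψo]
  exact Set.finite_image_iff (Primes.congr ψ).injective.injOn

/-- Cuspidality of elements of `Φ(A_⊚)^gp` is transported, given Prop. 5.3 (i) on primes.
[cite: MochizukiEtTh2009, Prop 5.3 (i) p.325 (PDF p.99)] -/
theorem isCuspidalGp_gpMap_iff_of_ordMap (hc : ∀ 𝔭, 𝔓.IsCuspidal (Primes.congr ψ 𝔭) ↔ 𝔓.IsCuspidal 𝔭)
    (x : Algebra.GrothendieckGroup 𝔉.PhiAcirc) :
    IsCuspidalGpOf' 𝔓 factor (ThetaFrobenioid.gpMap ψ.toMonoidHom x) ↔ IsCuspidalGpOf' 𝔓 factor x := by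
  change (∀ 𝔭 ∈ suppOf' factor (ThetaFrobenioid.gpMap ψ.toMonoidHom x), 𝔓.IsCuspidal 𝔭) ↔
    ∀ 𝔭 ∈ suppOf' factor x, 𝔓.IsCuspidal 𝔭
  rw [supp_gpMap_of_ordMap factor ψ hψo, Set.forall_mem_image]
  exact forall₂_congr fun 𝔭 _ => hc 𝔭

omit hψo in
/-- Linear equivalence is transported, given that `(Ψ^Φ_{A_⊚})^gp` preserves the principal elements `P` (F1-Ψ).
[cite: MochizukiEtTh2009, Prop 5.3 proof p.326 (PDF p.100)] -/
theorem linEquivOf_gpMap_iff (P : Subgroup (Algebra.GrothendieckGroup 𝔉.PhiAcirc))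
    (hP : ∀ x, ThetaFrobenioid.gpMap ψ.toMonoidHom x ∈ P ↔ x ∈ P) (x y : Algebra.GrothendieckGroup 𝔉.PhiAcirc) :
    LinEquivOf P (ThetaFrobenioid.gpMap ψ.toMonoidHom x) (ThetaFrobenioid.gpMap ψ.toMonoidHom y) ↔ LinEquivOf P x y := by
  change _ ∈ P ↔ _ ∈ P
  rw [← map_inv, ← map_mul, hP]

/-- **Cuspidal minimality is transported** (cuspidality, supports with their cardinalities and finiteness, linear
equivalence). [cite: MochizukiEtTh2009, Prop 5.3 proof p.326 (PDF p.100)] -/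
theorem isCuspidallyMinimalOf'_gpMap_iff_of_ordMap (hc : ∀ 𝔭, 𝔓.IsCuspidal (Primes.congr ψ 𝔭) ↔ 𝔓.IsCuspidal 𝔭)
    (P : Subgroup (Algebra.GrothendieckGroup 𝔉.PhiAcirc))
    (hP : ∀ x, ThetaFrobenioid.gpMap ψ.toMonoidHom x ∈ P ↔ x ∈ P) (x : Algebra.GrothendieckGroup 𝔉.PhiAcirc) :
    IsCuspidallyMinimalOf' 𝔓 factor P (ThetaFrobenioid.gpMap ψ.toMonoidHom x) ↔ IsCuspidallyMinimalOf' 𝔓 factor P x := by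
  constructor
  · rintro ⟨h1, h2, h3⟩
    refine ⟨(isCuspidalGp_gpMap_iff_of_ordMap 𝔓 factor ψ hψo hc x).mp h1,
      (finite_supp_gpMap_iff_of_ordMap factor ψ hψo x).mp h2, fun y hy hyf hyx => ?_⟩
    have := h3 (ThetaFrobenioid.gpMap ψ.toMonoidHom y) ((isCuspidalGp_gpMap_iff_of_ordMap 𝔓 factor ψ hψo hc y).mpr hy)
      ((finite_supp_gpMap_iff_of_ordMap factor ψ hψo y).mpr hyf) ((linEquivOf_gpMap_iff ψ P hP y x).mpr hyx)
    rwa [ncard_supp_gpMap_of_ordMap factor ψ hψo, ncard_supp_gpMap_of_ordMap factor ψ hψo] at this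
  · rintro ⟨h1, h2, h3⟩
    refine ⟨(isCuspidalGp_gpMap_iff_of_ordMap 𝔓 factor ψ hψo hc x).mpr h1,
      (finite_supp_gpMap_iff_of_ordMap factor ψ hψo x).mpr h2, fun y hy hyf hyx => ?_⟩
    rw [← DivisorSupportData.gpMap_gpMap_symm ψ y] at hy hyf hyx ⊢
    have := h3 _ ((isCuspidalGp_gpMap_iff_of_ordMap 𝔓 factor ψ hψo hc _).mp hy)
      ((finite_supp_gpMap_iff_of_ordMap factor ψ hψo _).mp hyf) ((linEquivOf_gpMap_iff ψ P hP _ x).mp hyx)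
    rwa [ncard_supp_gpMap_of_ordMap factor ψ hψo, ncard_supp_gpMap_of_ordMap factor ψ hψo]

end Transport

/-! ### Adjacency is preserved; Proposition 5.3 (v) -/

section Prop53v

variable {C : Type u} [Category.{v} C] {D : Type u'} [Category.{v'} D] {𝔉 : ThetaFrobenioid.{w} C D}
  (𝔓 : DivisorPrimeData 𝔉) (Ψ : C ≌ C) (ι : Ψ.functor.obj 𝔉.Acirc ≅ 𝔉.Acirc)
  (e : 𝔉.PhiAcirc ≃* 𝔉.pre.Mon (𝔉.base.obj (Ψ.functor.obj 𝔉.Acirc)))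

/-- **The adjacency of non-cuspidal primes is preserved by `Ψ^Φ_{A_⊚}`** — from the printed criterion (`hAdj`: "`𝔭, 𝔮` are
adjacent iff every cuspidally minimal `c` linearly equivalent to `a + b` has support of cardinality 4", with `b` corresponding
to `a` via the isomorphism of (ii)), Prop. 5.3 (i) on primes (`hc`), (ii) (`hii`), F1-Ψ (`hP`), and the transport of the
orders (`hψo`). [cite: MochizukiEtTh2009, Prop 5.3 proof p.327 (PDF p.101)] -/
theorem adjacency_preserved_of_orders (factor : 𝔉.PhiAcirc →* (Primes 𝔉.PhiAcirc → Multiplicative ℚ))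
    (P : Subgroup (Algebra.GrothendieckGroup 𝔉.PhiAcirc)) (hc : CuspPreserved 𝔓 Ψ ι e)
    (hii : PreservesNcspComponentIsos 𝔓 Ψ ι e hc)
    (hψo : ∀ (𝔭 : Primes 𝔉.PhiAcirc) (a : 𝔉.PhiAcirc),
      ordOf' factor (Primes.congr (psiPhi 𝔉 Ψ ι e) 𝔭) (psiPhi 𝔉 Ψ ι e a) = ordOf' factor 𝔭 a)
    (hP : ∀ x, ThetaFrobenioid.gpMap (psiPhi 𝔉 Ψ ι e).toMonoidHom x ∈ P ↔ x ∈ P)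
    (hAdj : ∀ (𝔭 𝔮 : Primes 𝔉.PhiAcirc) (h𝔭 : ¬ 𝔓.IsCuspidal 𝔭) (h𝔮 : ¬ 𝔓.IsCuspidal 𝔮), 𝔭 ≠ 𝔮 →
      ∀ a : 𝔭.submonoid, (a : 𝔉.PhiAcirc) ∈ 𝔭.carrier →
        (Adjacent 𝔓 ⟨𝔭, h𝔭⟩ ⟨𝔮, h𝔮⟩ ↔
          ∀ c, IsCuspidallyMinimalOf' 𝔓 factor P c →
            LinEquivOf P c (Algebra.GrothendieckGroup.of (a : 𝔉.PhiAcirc) *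
              Algebra.GrothendieckGroup.of (𝔓.ncspIso 𝔭 𝔮 h𝔭 h𝔮 a : 𝔉.PhiAcirc)) →
            (suppOf' factor c).ncard = 4))
    (𝔭 𝔮 : Primes 𝔉.PhiAcirc) (h𝔭 : ¬ 𝔓.IsCuspidal 𝔭) (h𝔮 : ¬ 𝔓.IsCuspidal 𝔮)
    (hadj : |𝔓.ncspEquivZ ⟨𝔭, h𝔭⟩ - 𝔓.ncspEquivZ ⟨𝔮, h𝔮⟩| = 1) :
    |𝔓.ncspEquivZ ⟨Primes.congr (psiPhi 𝔉 Ψ ι e) 𝔭, fun h => h𝔭 ((hc 𝔭).mp h)⟩ -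
        𝔓.ncspEquivZ ⟨Primes.congr (psiPhi 𝔉 Ψ ι e) 𝔮, fun h => h𝔮 ((hc 𝔮).mp h)⟩| = 1 := by
  set ψ := psiPhi 𝔉 Ψ ι e with hψ
  have hne : 𝔭 ≠ 𝔮 := by
    rintro rfl
    rw [sub_self, abs_zero] at hadj
    exact zero_ne_one hadj
  have h𝔭' : ¬ 𝔓.IsCuspidal (Primes.congr ψ 𝔭) := fun h => h𝔭 ((hc 𝔭).mp h)
  have h𝔮' : ¬ 𝔓.IsCuspidal (Primes.congr ψ 𝔮) := fun h => h𝔮 ((hc 𝔮).mp h)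
  have hne' : Primes.congr ψ 𝔭 ≠ Primes.congr ψ 𝔮 := fun h => hne ((Primes.congr ψ).injective h)
  obtain ⟨x₀, hx₀⟩ := Quotient.exists_rep 𝔭
  have ha₀ : (x₀.1 : 𝔉.PhiAcirc) ∈ 𝔭.carrier := ⟨x₀.2, hx₀⟩
  let a : 𝔭.submonoid := ⟨x₀.1, Submonoid.subset_closure ha₀⟩
  have ha : (a : 𝔉.PhiAcirc) ∈ 𝔭.carrier := ha₀
  have H4 := (hAdj 𝔭 𝔮 h𝔭 h𝔮 hne a ha).mp hadj
  let a' : (Primes.congr ψ 𝔭).submonoid := Primes.submonoidCongr ψ 𝔭 _ rfl a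
  have ha' : (a' : 𝔉.PhiAcirc) ∈ (Primes.congr ψ 𝔭).carrier := by
    rw [Primes.coe_submonoidCongr_apply, Primes.carrier_congr]
    exact ⟨_, ha, rfl⟩
  have hb' : (𝔓.ncspIso _ _ h𝔭' h𝔮' a' : 𝔉.PhiAcirc) = ψ (𝔓.ncspIso 𝔭 𝔮 h𝔭 h𝔮 a : 𝔉.PhiAcirc) :=
    (hii 𝔭 𝔮 h𝔭 h𝔮 hne a).symm
  refine (hAdj _ _ h𝔭' h𝔮' hne' a' ha').mpr fun c' hc' hlin => ?_
  have hcc : ThetaFrobenioid.gpMap ψ.toMonoidHom (ThetaFrobenioid.gpMap ψ.symm.toMonoidHom c') = c' :=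
    DivisorSupportData.gpMap_gpMap_symm ψ c'
  rw [← hcc] at hc' hlin ⊢
  rw [ncard_supp_gpMap_of_ordMap factor ψ hψo]
  refine H4 _ ((isCuspidallyMinimalOf'_gpMap_iff_of_ordMap 𝔓 factor ψ hψo hc P hP _).mp hc') ?_
  have hab : Algebra.GrothendieckGroup.of (a' : 𝔉.PhiAcirc) *
      Algebra.GrothendieckGroup.of (𝔓.ncspIso _ _ h𝔭' h𝔮' a' : 𝔉.PhiAcirc) =
      ThetaFrobenioid.gpMap ψ.toMonoidHom (Algebra.GrothendieckGroup.of (a : 𝔉.PhiAcirc) *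
        Algebra.GrothendieckGroup.of (𝔓.ncspIso 𝔭 𝔮 h𝔭 h𝔮 a : 𝔉.PhiAcirc)) := by
    rw [map_mul, ThetaFrobenioid.gpMap_of, ThetaFrobenioid.gpMap_of, hb', Primes.coe_submonoidCongr_apply,
      MulEquiv.coe_toMonoidHom]
  rw [hab] at hlin
  exact (linEquivOf_gpMap_iff ψ P hP _ _).mp hlin

/-- **[EtTh] Prop. 5.3 (v), NON-VACUOUS INSTANCE FORM over order coordinates (row F-0563)** — "`Ψ^Φ_{A_⊚}` preserves the
natural bijection `Prime(Φ(A_⊚))^ncsp ⥲ ℤ` up to `±1` and translation" — from: a product-valued factorization `factor`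
(Prop. 3.2 (i)) whose orders `Ψ^Φ_{A_⊚}` carries along (`hψo`), the principal elements `P` preserved by `(Ψ^Φ)^gp` (`hP`,
F1-Ψ), Prop. 5.3 (i) on primes (`hc`), (ii) (`hii`), and the printed adjacency criterion (`hAdj`, p.326–327); the last
step is abc-iut-L2-d4's rigidity of the chain (`preservesNcspLabels_of_adjacency`).  No "monoid type `ℤ`" structure enters,
so the structural data are satisfiable at PERFECT `Φ(A_⊚)` (Prop. 5.1).
[cite: MochizukiEtTh2009, Prop 5.3 (v) p.325 (PDF p.99); proof p.327 (PDF p.101)] -/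
theorem preservesNcspLabels_of_orders (factor : 𝔉.PhiAcirc →* (Primes 𝔉.PhiAcirc → Multiplicative ℚ))
    (P : Subgroup (Algebra.GrothendieckGroup 𝔉.PhiAcirc)) (hc : CuspPreserved 𝔓 Ψ ι e)
    (hii : PreservesNcspComponentIsos 𝔓 Ψ ι e hc)
    (hψo : ∀ (𝔭 : Primes 𝔉.PhiAcirc) (a : 𝔉.PhiAcirc),
      ordOf' factor (Primes.congr (psiPhi 𝔉 Ψ ι e) 𝔭) (psiPhi 𝔉 Ψ ι e a) = ordOf' factor 𝔭 a)
    (hP : ∀ x, ThetaFrobenioid.gpMap (psiPhi 𝔉 Ψ ι e).toMonoidHom x ∈ P ↔ x ∈ P)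
    (hAdj : ∀ (𝔭 𝔮 : Primes 𝔉.PhiAcirc) (h𝔭 : ¬ 𝔓.IsCuspidal 𝔭) (h𝔮 : ¬ 𝔓.IsCuspidal 𝔮), 𝔭 ≠ 𝔮 →
      ∀ a : 𝔭.submonoid, (a : 𝔉.PhiAcirc) ∈ 𝔭.carrier →
        (Adjacent 𝔓 ⟨𝔭, h𝔭⟩ ⟨𝔮, h𝔮⟩ ↔
          ∀ c, IsCuspidallyMinimalOf' 𝔓 factor P c →
            LinEquivOf P c (Algebra.GrothendieckGroup.of (a : 𝔉.PhiAcirc) *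
              Algebra.GrothendieckGroup.of (𝔓.ncspIso 𝔭 𝔮 h𝔭 h𝔮 a : 𝔉.PhiAcirc)) →
            (suppOf' factor c).ncard = 4)) :
    PreservesNcspLabels 𝔓 Ψ ι e hc :=
  preservesNcspLabels_of_adjacency 𝔓 Ψ ι e hc fun 𝔭 𝔮 h𝔭 h𝔮 h =>
    adjacency_preserved_of_orders 𝔓 Ψ ι e factor P hc hii hψo hP hAdj 𝔭 𝔮 h𝔭 h𝔮 h

end Prop53v

end FrobenioidThetaDivisors

end Literature.AnabelianGeometry.EtaleTheta
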